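import Literature.AlgebraicGeometry.Resolution.MacaulayficationDSequences
import HarnessLib

/-!
# Colon modules `P :_M a` and Kawasaki's form of `d`-sequences (Kawasaki 2000, Def. 2.1, Lemma 2.2)

Topic: `Literature/AlgebraicGeometry/Resolution`. Brick of the proof of the named facts
`KawasakiMacaulayfication` / `CesnaviciusMacaulayfication` (`Macaulayfication.lean`,
`MacaulayficationOverCMLocus.lean`), companion of `MacaulayficationDSequences.lean`. Kawasaki's
calculus of `p`-standard systems of parameters (Kawasaki 2000, §2–§3) is written entirely in
terms of colon submodules `(y₁,…,y_u, x_k,…,x_{l-1})M :_M x` of a fixed module `M` and of his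
form of the `d`-sequence condition,

  *Definition 2.1: `x₁,…,x_d` is a `d`-sequence on `M` if
  `(x₁,…,x_{i-1})M : xᵢxⱼ = (x₁,…,x_{i-1})M : xⱼ` for any `1 ≤ i ≤ j ≤ d`,*

always applied to quotient modules `M/(y₁,…,y_u)M` but computed inside `M`. This file provides
that vocabulary and identifies it with the tree's `IsDSequence` (Česnavičius 2021, Def. 3.7, the
injectivity form) on the quotient module:

* `colonBy P a = P :_M a` (the preimage of `P` under multiplication by `a`) and
  `colonByIdeal P I = P :_M I`, with their calculus (`colonBy_mul`: `P : ab = (P : a) : b`, …);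
* `comap_mkQ_smul_top`, `mkQ_mem_smul_top_iff` — `(I·(M/N))` pulled back to `M` is `N + IM`;
* `IsKDSequence N zs` — Kawasaki's Def. 2.1 for the module `M/N`, computed in `M`:
  `(N + (z₁,…,z_{i-1})M) :_M zᵢzⱼ = (N + (z₁,…,z_{i-1})M) :_M zⱼ` for `i ≤ j`;
* `IsKDSequence.mem_of_smul_mem` — Kawasaki's form implies the injectivity form
  `((z₁,…,z_{i-1})M̄ : zᵢ) ∩ 𝔮M̄ = (z₁,…,z_{i-1})M̄` on `M̄ = M/N` (the case `n = 1` of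
  Kawasaki 2000, Lemma 2.2, proved as printed there: descending induction on `i` using the
  conditions at `(i, i+1)` and `(i, i)`), and `isKDSequence_iff_isDSequence_quotient` — the two
  definitions agree (Česnavičius 2021, Rem. 3.8, citing HIO (38.6) b)).

Everything is proved; no named fact is introduced; no Noetherian or finiteness hypothesis.

## References

* [Kawasaki2000] T. Kawasaki, *On Macaulayfication of Noetherian schemes*, Trans. AMS 352 (2000)
  2517–2552, Def. 2.1, Lemma 2.2 (and its proof).
* [Cesnavicius2021] K. Česnavičius, *Macaulayfication of Noetherian schemes*, Duke Math. J. 170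
  (2021) = arXiv:1810.04493v2, Def. 3.7, Rem. 3.8.
* [Huneke1982] C. Huneke, *The theory of d-sequences and powers of ideals*, Adv. Math. 46 (1982).
-/

namespace Literature.AlgebraicGeometry.Resolution

open Ideal Submodule
open scoped Pointwise

universe u v

variable {R : Type u} [CommRing R] {M : Type v} [AddCommGroup M] [Module R M]

/-! ## Colon submodules -/

/-- The **colon submodule** `P :_M a = {m ∈ M | a·m ∈ P}` of a submodule `P ⊆ M` by a ring
element `a` (the preimage of `P` under multiplication by `a`). [folklore] -/
def colonBy (P : Submodule R M) (a : R) : Submodule R M :=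
  P.comap (LinearMap.lsmul R M a)

/-- The **colon submodule by an ideal** `P :_M I = {m ∈ M | I·m ⊆ P}`. [folklore] -/
def colonByIdeal (P : Submodule R M) (I : Ideal R) : Submodule R M where
  carrier := {m | ∀ a ∈ I, a • m ∈ P}
  add_mem' := fun {m m'} hm hm' a ha => by
    rw [smul_add]
    exact P.add_mem (hm a ha) (hm' a ha)
  zero_mem' := fun a _ => by
    rw [smul_zero]
    exact P.zero_mem
  smul_mem' := fun c {m} hm a ha => by
    rw [smul_comm]
    exact P.smul_mem c (hm a ha)

/-- Membership in `P :_M a`. [folklore] -/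
@[simp]
theorem mem_colonBy {P : Submodule R M} {a : R} {m : M} : m ∈ colonBy P a ↔ a • m ∈ P :=
  Iff.rfl

/-- Membership in `P :_M I`. [folklore] -/
@[simp]
theorem mem_colonByIdeal {P : Submodule R M} {I : Ideal R} {m : M} :
    m ∈ colonByIdeal P I ↔ ∀ a ∈ I, a • m ∈ P :=
  Iff.rfl

/-- `colonBy` is the tree's earlier spelling `P.comap (LinearMap.lsmul R M a)`. [folklore] -/
theorem colonBy_eq_comap (P : Submodule R M) (a : R) :
    colonBy P a = P.comap (LinearMap.lsmul R M a) :=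
  rfl

/-- `P ⊆ P : a`. [folklore] -/
theorem le_colonBy (P : Submodule R M) (a : R) : P ≤ colonBy P a :=
  fun _ hm => P.smul_mem a hm

/-- `P : a` is monotone in `P`. [folklore] -/
theorem colonBy_mono {P Q : Submodule R M} (h : P ≤ Q) (a : R) : colonBy P a ≤ colonBy Q a :=
  fun _ hm => h hm

/-- `P : 1 = P`. [folklore] -/
@[simp]
theorem colonBy_one (P : Submodule R M) : colonBy P 1 = P := by
  ext m
  rw [mem_colonBy, one_smul]

/-- `⊤ : a = ⊤`. [folklore] -/
@[simp]
theorem colonBy_top (a : R) : colonBy (⊤ : Submodule R M) a = ⊤ :=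
  eq_top_iff.mpr fun _ _ => Submodule.mem_top

/-- **`P : ab = (P : a) : b`.** [folklore] -/
theorem colonBy_mul (P : Submodule R M) (a b : R) : colonBy P (a * b) = colonBy (colonBy P a) b := by
  ext m
  simp only [mem_colonBy, mul_smul]

/-- `(P : a) : b = (P : b) : a`. [folklore] -/
theorem colonBy_colonBy_comm (P : Submodule R M) (a b : R) :
    colonBy (colonBy P a) b = colonBy (colonBy P b) a := by
  rw [← colonBy_mul, mul_comm, colonBy_mul]

/-- `P : b ⊆ P : ab`. [folklore] -/
theorem colonBy_le_colonBy_mul (P : Submodule R M) (a b : R) : colonBy P b ≤ colonBy P (a * b) := by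
  rw [mul_comm, colonBy_mul]
  exact le_colonBy _ _

/-- `P : a ⊆ P : aⁿ⁺¹`. [folklore] -/
theorem colonBy_le_colonBy_pow_succ (P : Submodule R M) (a : R) (n : ℕ) :
    colonBy P a ≤ colonBy P (a ^ (n + 1)) := by
  rw [pow_succ]
  exact colonBy_le_colonBy_mul P (a ^ n) a

/-- `a·(P : a) ⊆ P`. [folklore] -/
theorem smul_colonBy_le (P : Submodule R M) (a : R) : a • colonBy P a ≤ P := by
  rintro _ ⟨m, hm, rfl⟩
  exact hm

/-- `P : I ⊆ P : a` for `a ∈ I`. [folklore] -/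
theorem colonByIdeal_le_colonBy (P : Submodule R M) {I : Ideal R} {a : R} (ha : a ∈ I) :
    colonByIdeal P I ≤ colonBy P a :=
  fun _ hm => hm a ha

/-- `P ⊆ P : I`. [folklore] -/
theorem le_colonByIdeal (P : Submodule R M) (I : Ideal R) : P ≤ colonByIdeal P I :=
  fun _ hm a _ => P.smul_mem a hm

/-- To lie in `P : I` it suffices to be in `P : a` for a set of generators `a` of `I`.
[folklore] -/
theorem mem_colonByIdeal_span_iff {P : Submodule R M} {s : Set R} {m : M} :
    m ∈ colonByIdeal P (Ideal.span s) ↔ ∀ a ∈ s, a • m ∈ P := by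
  refine ⟨fun h a ha => h a (Ideal.subset_span ha), fun h a ha => ?_⟩
  refine Submodule.span_induction (p := fun a _ => a • m ∈ P) h ?_ ?_ ?_ ha
  · rw [zero_smul]; exact P.zero_mem
  · intro x y _ _ hx hy
    rw [add_smul]; exact P.add_mem hx hy
  · intro c x _ hx
    rw [smul_eq_mul, mul_smul]; exact P.smul_mem c hx

/-- `P : (z₁,…,z_s) = ⋂ᵢ P : zᵢ`. [folklore] -/
theorem mem_colonByIdeal_ofList_iff {P : Submodule R M} {zs : List R} {m : M} :
    m ∈ colonByIdeal P (ofList zs) ↔ ∀ a ∈ zs, a • m ∈ P :=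
  mem_colonByIdeal_span_iff

/-! ## Pulling submodules of `M/N` back to `M` -/

/-- **`I·(M/N)` pulled back to `M` is `N + IM`.** [folklore] -/
theorem comap_mkQ_smul_top (N : Submodule R M) (I : Ideal R) :
    (I • (⊤ : Submodule R (M ⧸ N))).comap N.mkQ = N ⊔ I • ⊤ := by
  calc (I • (⊤ : Submodule R (M ⧸ N))).comap N.mkQ
      = ((I • (⊤ : Submodule R M)).map N.mkQ).comap N.mkQ := by
        rw [Submodule.map_smul'', Submodule.map_top, Submodule.range_mkQ]
    _ = I • ⊤ ⊔ LinearMap.ker N.mkQ := Submodule.comap_map_eq _ _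
    _ = N ⊔ I • ⊤ := by rw [Submodule.ker_mkQ, sup_comm]

/-- `m̄ ∈ I·(M/N)` iff `m ∈ N + IM`. [folklore] -/
theorem mkQ_mem_smul_top_iff (N : Submodule R M) (I : Ideal R) (m : M) :
    N.mkQ m ∈ (I • (⊤ : Submodule R (M ⧸ N))) ↔ m ∈ N ⊔ I • ⊤ := by
  rw [← Submodule.mem_comap, comap_mkQ_smul_top]

/-- `N + (z₁,…,zᵢ₊₁)M = (N + (z₁,…,zᵢ)M) + zᵢ₊₁M`. [folklore] -/
theorem sup_ofList_take_succ_smul_top (N : Submodule R M) (zs : List R) {i : ℕ}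
    (hi : i < zs.length) :
    N ⊔ ofList (zs.take (i + 1)) • (⊤ : Submodule R M) =
      (N ⊔ ofList (zs.take i) • ⊤) ⊔ zs[i] • ⊤ := by
  rw [ofList_take_succ zs hi, Submodule.sup_smul, Submodule.ideal_span_singleton_smul, sup_assoc]

/-- Membership in `P + aM`: `m = w + a·c` with `w ∈ P`. [folklore] -/
theorem mem_sup_smul_top_iff {P : Submodule R M} {a : R} {m : M} :
    m ∈ P ⊔ a • (⊤ : Submodule R M) ↔ ∃ w ∈ P, ∃ c : M, m = w + a • c := by
  constructor
  · intro hm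
    obtain ⟨w, hw, y, hy, rfl⟩ := Submodule.mem_sup.mp hm
    obtain ⟨c, _, rfl⟩ := (Submodule.mem_smul_pointwise_iff_exists y a _).mp hy
    exact ⟨w, hw, c, rfl⟩
  · rintro ⟨w, hw, c, rfl⟩
    exact Submodule.add_mem_sup hw (Submodule.smul_mem_pointwise_smul c a ⊤ Submodule.mem_top)

/-! ## Kawasaki's form of the `d`-sequence condition -/

/-- **`d`-sequence in Kawasaki's form, on a quotient module** (Kawasaki 2000, Def. 2.1, for the
module `M/N`, computed in `M`): `zs = [z₁,…,z_s]` satisfies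
`(N + (z₁,…,z_{i-1})M) :_M zᵢzⱼ = (N + (z₁,…,z_{i-1})M) :_M zⱼ` for all `1 ≤ i ≤ j ≤ s`.
Splits `zs = A ++ a :: B` enumerate `(z₁,…,z_{i-1}), zᵢ, (z_{i+1},…)` and `b ∈ a :: B` the
`zⱼ` with `j ≥ i`. (For `N = (y₁,…,y_u)M` this is "`z₁,…,z_s` is a `d`-sequence on
`M/(y₁,…,y_u)M`", the form of Kawasaki 2000, Cor. 2.10.) [cite: Kawasaki2000, Def. 2.1] -/
def IsKDSequence (N : Submodule R M) (zs : List R) : Prop :=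
  ∀ (A : List R) (a : R) (B : List R), zs = A ++ a :: B → ∀ b ∈ a :: B,
    colonBy (N ⊔ ofList A • ⊤) (a * b) = colonBy (N ⊔ ofList A • ⊤) b

namespace IsKDSequence

variable {N : Submodule R M} {zs : List R}

/-- The condition of Def. 2.1 at the indices `(i, j)`, `i ≤ j`, in `getElem` form. [folklore] -/
theorem colonBy_mul_eq (h : IsKDSequence N zs) {i j : ℕ} (hij : i ≤ j) (hj : j < zs.length) :
    colonBy (N ⊔ ofList (zs.take i) • ⊤) (zs[i] * zs[j]) =
      colonBy (N ⊔ ofList (zs.take i) • ⊤) zs[j] := by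
  have hi : i < zs.length := lt_of_le_of_lt hij hj
  have hsplit : zs = zs.take i ++ zs[i] :: zs.drop (i + 1) := by
    conv_lhs => rw [← List.take_append_drop i zs, List.drop_eq_getElem_cons hi]
  refine h (zs.take i) zs[i] (zs.drop (i + 1)) hsplit zs[j] ?_
  rw [← List.drop_eq_getElem_cons hi, List.mem_iff_getElem]
  refine ⟨j - i, by rw [List.length_drop]; omega, ?_⟩
  rw [List.getElem_drop]
  congr 1
  omega

/-- **Kawasaki's form implies the injectivity form** (the case `n = 1` of Kawasaki 2000,
Lemma 2.2, proved exactly as printed there): if `zs` is a `d`-sequence on `M/N` in the sense of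
Def. 2.1, `m ∈ N + (z₁,…,z_s)M` and `zᵢm ∈ N + (z₁,…,z_{i-1})M`, then
`m ∈ N + (z₁,…,z_{i-1})M`. Descending induction on `i`: `zᵢz_{i+1}m ∈ N + (z_{<i})M` gives
`z_{i+1}m ∈ N + (z_{<i})M` by the condition at `(i, i+1)`, hence `m ∈ N + (z_{≤ i})M` by the
statement at `i + 1`; writing `m = w + zᵢc`, `zᵢ²c ∈ N + (z_{<i})M`, so `zᵢc ∈ N + (z_{<i})M`
by the condition at `(i, i)`. [cite: Kawasaki2000, Lemma 2.2] -/
theorem mem_of_smul_mem (h : IsKDSequence N zs) {i : ℕ} (hi : i < zs.length) {m : M}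
    (hm : m ∈ N ⊔ ofList zs • ⊤) (hzm : zs[i] • m ∈ N ⊔ ofList (zs.take i) • ⊤) :
    m ∈ N ⊔ ofList (zs.take i) • (⊤ : Submodule R M) := by
  -- descending induction on `i`, measured by `k` with `zs.length ≤ i + k`
  suffices key : ∀ k i, zs.length ≤ i + k → ∀ hi : i < zs.length, ∀ m : M,
      m ∈ N ⊔ ofList zs • ⊤ → zs[i] • m ∈ N ⊔ ofList (zs.take i) • ⊤ →
        m ∈ N ⊔ ofList (zs.take i) • (⊤ : Submodule R M) from
    key zs.length i (by omega) hi m hm hzm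
  intro k
  induction k with
  | zero => intro i hik hi; omega
  | succ k ih =>
    intro i hik hi m hm hzm
    -- Step 1: `m ∈ N + (z₁,…,zᵢ₊₁)M` (`0`-based: `take (i + 1)`)
    have step1 : m ∈ N ⊔ ofList (zs.take (i + 1)) • (⊤ : Submodule R M) := by
      by_cases hi1 : i + 1 < zs.length
      · refine ih (i + 1) (by omega) hi1 m hm ?_
        -- `zᵢ₊₁ m ∈ N + (z_{<i})M ⊆ N + (z_{≤ i})M` by the condition at `(i, i+1)`
        have hmem : m ∈ colonBy (N ⊔ ofList (zs.take i) • ⊤) (zs[i] * zs[i + 1]) := by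
          rw [mem_colonBy, mul_comm, mul_smul]
          exact Submodule.smul_mem _ _ hzm
        rw [h.colonBy_mul_eq (Nat.le_succ i) hi1, mem_colonBy] at hmem
        exact sup_le_sup_left (smul_mono_left (ofList_take_mono zs (Nat.le_succ i))) N hmem
      · have hlen : zs.length = i + 1 := by omega
        rwa [← hlen, List.take_length]
    -- Step 2: write `m = w + zᵢ c` and use the condition at `(i, i)`
    rw [sup_ofList_take_succ_smul_top N zs hi, mem_sup_smul_top_iff] at step1
    obtain ⟨w, hw, c, rfl⟩ := step1
    have hzc : zs[i] • (zs[i] • c) ∈ N ⊔ ofList (zs.take i) • (⊤ : Submodule R M) := by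
      have := Submodule.sub_mem _ hzm (Submodule.smul_mem _ zs[i] hw)
      rwa [smul_add, add_sub_cancel_left] at this
    have hc : c ∈ colonBy (N ⊔ ofList (zs.take i) • ⊤) (zs[i] * zs[i]) := by
      rwa [mem_colonBy, mul_smul]
    rw [h.colonBy_mul_eq le_rfl hi, mem_colonBy] at hc
    exact Submodule.add_mem _ hw hc

/-- **Kawasaki's form implies the tree's `IsDSequence` on the quotient module** (Česnavičius
2021, Rem. 3.8: the two definitions of `d`-sequence agree). [cite: Cesnavicius2021, Rem. 3.8] -/
theorem isDSequence_quotient (h : IsKDSequence N zs) : IsDSequence (M ⧸ N) zs := by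
  refine ⟨fun i hi x hx hzx => ?_⟩
  obtain ⟨m, rfl⟩ := N.mkQ_surjective x
  rw [mkQ_mem_smul_top_iff] at hx
  rw [← map_smul, mkQ_mem_smul_top_iff] at hzx
  rw [mkQ_mem_smul_top_iff]
  exact h.mem_of_smul_mem hi hx hzx

end IsKDSequence

/-- **The injectivity form implies Kawasaki's form** (the easy direction of Česnavičius 2021,
Rem. 3.8: "the `rᵢ`-torsion and the `rᵢrᵢ'`-torsion submodules of `M/(r₁,…,r_{i-1})M` agree"):
if `zs` is a `d`-sequence for `M/N` then `(N + (z_{<i})M) : zᵢzⱼ = (N + (z_{<i})M) : zⱼ` for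
`i ≤ j`. [cite: Cesnavicius2021, Rem. 3.8] -/
theorem isKDSequence_of_isDSequence_quotient {N : Submodule R M} {zs : List R}
    (h : IsDSequence (M ⧸ N) zs) : IsKDSequence N zs := by
  intro A a B hsplit b hb
  refine le_antisymm (fun m hm => ?_) (colonBy_le_colonBy_mul _ a b)
  rw [mem_colonBy, mul_smul] at hm
  rw [mem_colonBy]
  have hi : A.length < zs.length := by rw [hsplit, List.length_append, List.length_cons]; omega
  have hA : zs.take A.length = A := by rw [hsplit, List.take_left]
  have ha : zs[A.length] = a := by
    simp only [hsplit, List.getElem_append_right le_rfl, Nat.sub_self, List.getElem_cons_zero]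
  have hbzs : b ∈ zs := by rw [hsplit]; exact List.mem_append_right A hb
  -- `b m ∈ (zs)M`, `a (b m) ∈ N + (A)M`, so `b m ∈ N + (A)M` by injectivity at index `|A|`
  have key := h.mem_of_smul_mem A.length hi (N.mkQ (b • m))
    ((mkQ_mem_smul_top_iff N _ _).mpr (Submodule.mem_sup_right
      (Submodule.smul_mem_smul (Ideal.subset_span hbzs) Submodule.mem_top)))
  rw [← map_smul, mkQ_mem_smul_top_iff, mkQ_mem_smul_top_iff, hA, ha] at key
  exact key hm

/-- **Kawasaki's Def. 2.1 on `M/N` ⇔ the tree's `IsDSequence (M ⧸ N)`** (Česnavičius 2021,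
Rem. 3.8, citing Herrmann–Ikeda–Orbanz (38.6) b)). [cite: Cesnavicius2021, Rem. 3.8] -/
theorem isKDSequence_iff_isDSequence_quotient (N : Submodule R M) (zs : List R) :
    IsKDSequence N zs ↔ IsDSequence (M ⧸ N) zs :=
  ⟨IsKDSequence.isDSequence_quotient, isKDSequence_of_isDSequence_quotient⟩

/-- **Goto–Yamagishi on a quotient, pulled back to `M`** (Kawasaki 2000, Lemma 2.2 for the
module `M/N`): if `zs` is a `d`-sequence on `M/N` in Kawasaki's sense and `𝔮 = (z₁,…,z_s)`, then
`((N + (z_{<i})M) :_M zᵢ) ∩ (N + 𝔮ⁿ⁺¹M) = N + (z_{<i})𝔮ⁿM`. [cite: Kawasaki2000, Lemma 2.2] -/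
theorem IsKDSequence.colonBy_inf_sup_pow_smul_top {N : Submodule R M} {zs : List R}
    (h : IsKDSequence N zs) (n : ℕ) {i : ℕ} (hi : i < zs.length) :
    colonBy (N ⊔ ofList (zs.take i) • ⊤) zs[i] ⊓ (N ⊔ ofList zs ^ (n + 1) • ⊤) =
      N ⊔ ofList (zs.take i) • (ofList zs ^ n • (⊤ : Submodule R M)) := by
  have hq := (h.isDSequence_quotient).colon_inf_pow_smul_top n hi
  -- pull back along `M → M/N`
  have e1 : (Submodule.comap (LinearMap.lsmul R (M ⧸ N) zs[i])
      (ofList (zs.take i) • (⊤ : Submodule R (M ⧸ N)))).comap N.mkQ =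
        colonBy (N ⊔ ofList (zs.take i) • ⊤) zs[i] := by
    ext m
    simp only [Submodule.mem_comap, LinearMap.lsmul_apply, mem_colonBy, Submodule.mkQ_apply]
    rw [← Submodule.mkQ_apply, ← map_smul, mkQ_mem_smul_top_iff]
  have e2 : ∀ (I : Ideal R), (I • (ofList zs ^ n • (⊤ : Submodule R (M ⧸ N)))).comap N.mkQ =
      N ⊔ I • (ofList zs ^ n • ⊤) := fun I => by
    rw [← Submodule.mul_smul, comap_mkQ_smul_top, Submodule.mul_smul]
  have := congrArg (Submodule.comap N.mkQ) hq
  rw [Submodule.comap_inf, e1, comap_mkQ_smul_top, e2] at this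
  exact this

end Literature.AlgebraicGeometry.Resolution
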